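/-
Copyright (c) 2026 the pub-hodgecm-mathlib formalisation cell (harness21).  Prover seat hodgecm-mathlib-K2E3-p12 (g8), Track B ∕ K2-LIT, h413 = `stmt-HodgeConjecture-24833`,
line `K2_E1_TraceFormulaBeta`, campaign «R8₂-sph EXHAUSTION» road of record after ruling (130), deal (142) «f3-χ» of the dealer K2E1-plan (g7): FILE D0-χ = the toolkit of the TWISTED
radial pseudo-Eisenstein series `θ_{f,ψ} = E((f∘H)·ψ)` of `U(1,1)_{L∕L⁺}` for a continuous bounded left-`N(𝔸)B(L⁺)`-invariant coefficient `ψ` (a `χ`-section), the `ψ`-twin of ★ D0 p859615.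
-/
import Summits.HodgeConjecture.HodgeConjecture.Theorems.K2E1PseudoEisensteinRadialCMTwo        -- ★ D0 p859615 (this seat): the `ψ = 1` toolkit (flat-section disguise, cusp vanishing, case split, unfolding); brings ★ A, ★ B, reduction theory
import Summits.HodgeConjecture.HodgeConjecture.Theorems.K2E1ChiEisensteinConstantTermCMTwo     -- ★ (K2E4-p23∕K2E1): `borelConstantTerm_eisensteinSeriesU_flatSectionU_cm_two` (SECTION-GENERIC constant term, `Re z > 1`), ★ `IsChiSection` currency
import HarnessLib

/-!
# f3-χ FILE D0-χ — `K2E1ChiPseudoEisensteinRadialCMTwo`: THE TWISTED RADIAL PSEUDO-EISENSTEIN SERIES `θ_{f,ψ}(g) = Σ_{γ ∈ B(F)∖G(F)} f(H(γg))·ψ(γg)` OF `U(1,1)_{L∕L⁺}` —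
# flat-section form, summability, continuity, `G(F)`-invariance, CUSP VANISHING, BOUNDEDNESS, the CONSTANT TERM, and the MELLIN FORM of its intertwining integral

Track B ∕ K2-LIT, crux h413 = `stmt-HodgeConjecture-24833`, route of record `HCCMUnconditional`; cell `hodgecm-mathlib`, squad K2, ENGINE E1.  THEOREMS ONLY (no `def`, no `instance`,
no `notation`, no named-fact hypothesis, no `sorry`); lane `--supports stmt-HodgeConjecture-24833 --as helper` (count-neutral).  Convention of record = LEFT (★ `eisensteinSeriesU`,
`borelConstantTerm ν 𝓕 φ g = (ν𝓕)⁻¹∫_𝓕 φ(ug) dν`).  COEFFICIENT-GENERIC: `ψ : G(𝔸) → ℂ` continuous, bounded, left-`N(𝔸)`- and left-`B(F)`-invariant — e.g. a `χ`-section of the (χ,τ)-currency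
(★ `IsChiSection χ ψ`: ★ `IsChiSection.unipotent_mul`, ★ `.toAdelic_mul`; bounded when `χ` is unitary and `ψ` is continuous), `ψ = 1` being ★ D0.
THE MATHEMATICS ([MoeglinWaldspurger1995, II.1.2–II.1.7]; [GelbartRogawski1991, §3.1]; [Garrett2018, §1.8, §2.8–§2.11]).  `(f∘H)·ψ = flatSectionU (H^{−σ}·(f∘H)·ψ) σ` (§1) with a continuous
BOUNDED left-`N(𝔸)B(F)`-invariant coefficient, so the ★ flat-section theorems apply at `z = σ = 2` exactly as in ★ D0: summability, continuity, `G(F)`-invariance, Godement finiteness; CUSP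
VANISHING (`θ_{f,ψ} = 0` on `{H > T}` when `f = 0` off `(T⁻¹, T)`, `T ≥ 1` — the terms vanish through `f` alone, ★ big cell) and BOUNDEDNESS (★ reduction theory + compact low Siegel part +
★ D0's case split); the CONSTANT TERM is the SECTION-GENERIC ★ `borelConstantTerm_eisensteinSeriesU_flatSectionU_cm_two`: **`θ_{f,ψ,B}(g) = f(Hg)ψ(g) + (ν𝓕)⁻¹•∫_{N(𝔸)} f(H(w₀vg))ψ(w₀vg) dν`**;
and Mellin inversion (★ A) under the `ν`-integral with Godement's majorant `‖ψ‖_∞·H(w₀vg)^{σ₀}` (★, `σ₀ > 1`) gives the MELLIN FORM of the intertwining integral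
**`∫_{N(𝔸)} f(H(w₀vg))ψ(w₀vg) dν = (2π)⁻¹∫_ℝ f̃(z)·(∫_{N(𝔸)} (ψ·H^z)(w₀vg) dν) dy`**, `z = σ₀ + iy`, `f̃(z) = mellin f (−z)` — the inner integral is `(M(z)ψ)(g)·H(g)^{1−z}` with the
INTERTWINED COEFFICIENT `M(z)ψ` of ★ row 3 `K2E1ChiIntertwinedSectionU2` (a `χʷ`-section when `ψ` is a `χ`-section), the `ψ`-twin of ★ B's scalar `c(z)`.
* §1 (generic `(F,E,c)`): `comp_borelHeight_mul_eq_flatSectionU`, `continuous_∕exists_bound_twistedCoeff`, invariance lemmas, `eisensteinSeriesU_comp_borelHeight_mul_arithmeticSubgroup_mul`,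
  `eisensteinSeriesU_comp_borelHeight_mul_eq_zero_of_lt` (cusp vanishing).
* §2 (CM, `N = 2`): `summable_∕continuous_∕measurable_eisensteinSeriesU_comp_borelHeight_mul_cm_two`, **`exists_bound_eisensteinSeriesU_comp_borelHeight_mul_cm_two`**,
  **`borelConstantTerm_eisensteinSeriesU_comp_borelHeight_mul_cm_two`**, `integrable_flatSectionU_mul_mellin_prod_cm_two`, **`integral_comp_borelHeight_mul_weylLongU_eq_mellin_cm_two`**.
HONEST LABEL: HC_CM is proved only modulo the 7 printed citations (2 remaining named inputs: hLiu418 = `stmt-HodgeConjecture-24832`, h413 = `stmt-HodgeConjecture-24833`) until rung 0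
closes; this file asserts no named fact, closes no socket; count-neutral; letter-free.

## References
* [MoeglinWaldspurger1995] C. Mœglin, J.-L. Waldspurger, *Spectral decomposition and Eisenstein series* (1995), I.2.13, II.1.2–II.1.7.
* [GelbartRogawski1991] S. Gelbart, J. Rogawski, *L-functions and Fourier–Jacobi coefficients for the unitary group U(3)*, Invent. Math. 105 (1991), §3.1.
* [Garrett2018] P. Garrett, *Modern Analysis of Automorphic Forms by Example* (2018), §1.8, §2.8–§2.11.
* [Titchmarsh1948] E. C. Titchmarsh, *Introduction to the Theory of Fourier Integrals* (1948), Thm 71–72.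
-/

set_option autoImplicit false
set_option linter.dupNamespace false  -- the mandated namespace repeats the summit's segment (`HodgeConjecture.HodgeConjecture`)

noncomputable section

open MeasureTheory Measure Set Filter Topology Complex NumberField IsDedekindDomain MulAction
open scoped Real NNReal ENNReal ComplexConjugate Pointwise
open Literature.MeasureTheory.Group Literature.NumberTheory
open Literature.NumberTheory.Automorphic Literature.NumberTheory.Automorphic.UnitaryGroup AdelicGroupData
open Summit.HodgeConjecture.HodgeConjecture.Cruxes.H413.K2E1BorelEisensteinU
open Summit.HodgeConjecture.HodgeConjecture.Cruxes.H413.K2E1MellinPaleyWienerHalfLine (continuous_ofReal_cpow_mul eq_integral_cpow_mul_mellin_neg verticalIntegrable_mellin differentiable_mellin)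
open Summit.HodgeConjecture.HodgeConjecture.Cruxes.H413.K2E1BorelCosetsDictionary (eisensteinSeriesU_eq_tsum_arithmeticBorelQuot forall_arithmeticBorel_iff)
open Summit.HodgeConjecture.HodgeConjecture.Cruxes.H413.K2E1MaassSelbergCMTwo (summable_flatSectionU_cm_two)
open Summit.HodgeConjecture.HodgeConjecture.Cruxes.H413.K2E1BorelEisensteinRegularU (continuous_eisensteinSeriesU_flatSectionU_cm_two)
open Summit.HodgeConjecture.HodgeConjecture.Cruxes.H413.K2E1TruncatedEisensteinBoundedCMThree (eisensteinSeriesU_flatSectionU_arithmeticSubgroup_mul)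
open Summit.HodgeConjecture.HodgeConjecture.Cruxes.H413.K2E1TruncatedEisensteinBoundedCMTwo (reductionTheoryU_two_antidiagonal exists_isCompact_siegel_low_two)
open Summit.HodgeConjecture.HodgeConjecture.Cruxes.H413.K2E1TruncatedEisensteinL2 (exists_bound_low_of_isCompact)
open Summit.HodgeConjecture.HodgeConjecture.Cruxes.H413.K2E1IntertwinedCoeffContinuousCMTwo (integrable_borelHeight_weylLongU_mul_rpow_cm_two)
open Summit.HodgeConjecture.HodgeConjecture.Cruxes.H413.K2E1UnipotentHaarNormalisationU2 (isInvInvariant_of_isHaarMeasure_two)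
open Summit.HodgeConjecture.HodgeConjecture.Cruxes.H413.K2E1SphericalIntertwiningMellinCMTwo (sigmaFinite_haar_adelicUnipotent_cm_two)
open Summit.HodgeConjecture.HodgeConjecture.Cruxes.H413.K2E1ChiEisensteinConstantTermCMTwo (borelConstantTerm_eisensteinSeriesU_flatSectionU_cm_two)
open Summit.HodgeConjecture.HodgeConjecture.Cruxes.H413.K2E1PseudoEisensteinRadialCMTwo (continuous_radialCoeff exists_bound_radialCoeff exists_one_le_forall_eq_zero norm_le_of_cover_of_eq_zero)

namespace Summit.HodgeConjecture.HodgeConjecture.Cruxes.H413.K2E1ChiPseudoEisensteinRadialCMTwo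

/-! ## §1 Generic `(F, E, c)`: the twisted radial section as a flat section; invariance; cusp vanishing -/

section Generic

variable {F E : Type} [Field F] [NumberField F] [Field E] [NumberField E] [Algebra F E] {c : E ≃ₐ[F] E} {N : ℕ} [NeZero N]

/-- **THE TWISTED RADIAL SECTION IS A FLAT SECTION**: `(f∘H)·ψ = flatSectionU (H^{−σ}·(f∘H)·ψ) σ` (`H > 0`), every `f`, `ψ` and real `σ`. [cite: MoeglinWaldspurger1995, II.1.2] -/
theorem comp_borelHeight_mul_eq_flatSectionU (f : ℝ → ℂ) (σ : ℝ) (ψ : (quasiSplit F E c N).Adelic → ℂ) :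
    (fun g : (quasiSplit F E c N).Adelic => f (borelHeight g : ℝ) * ψ g) =
      flatSectionU (fun g : (quasiSplit F E c N).Adelic => ((borelHeight g : ℝ) : ℂ) ^ (-(σ : ℂ)) * f (borelHeight g : ℝ) * ψ g) (σ : ℂ) := by
  funext g
  have hH : ((borelHeight g : ℝ) : ℂ) ≠ 0 := ofReal_ne_zero.2 (ne_of_gt (by exact_mod_cast borelHeight_pos g))
  have h1 : ((borelHeight g : ℝ) : ℂ) ^ (-(σ : ℂ)) * ((borelHeight g : ℝ) : ℂ) ^ (σ : ℂ) = 1 := by rw [← cpow_add _ _ hH, neg_add_cancel, cpow_zero]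
  rw [flatSectionU_apply]
  linear_combination (-(f (borelHeight g : ℝ) * ψ g)) * h1

/-- The twisted coefficient `H^{−σ}·(f∘H)·ψ` is continuous for `f` continuous with `tsupport f ⊆ (0,∞)` and `ψ` continuous. [cite: MoeglinWaldspurger1995, II.1.2] -/
theorem continuous_twistedCoeff {f : ℝ → ℂ} (hfc : Continuous f) (hf0 : tsupport f ⊆ Ioi 0) (σ : ℝ) {ψ : (quasiSplit F E c N).Adelic → ℂ} (hψc : Continuous ψ) :
    Continuous fun g : (quasiSplit F E c N).Adelic => ((borelHeight g : ℝ) : ℂ) ^ (-(σ : ℂ)) * f (borelHeight g : ℝ) * ψ g :=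
  (continuous_radialCoeff hfc hf0 σ).mul hψc

/-- The twisted coefficient is BOUNDED for `f ∈ C_c((0,∞))` and `ψ` bounded. [cite: MoeglinWaldspurger1995, II.1.2] -/
theorem exists_bound_twistedCoeff {f : ℝ → ℂ} (hfc : Continuous f) (hfs : HasCompactSupport f) (hf0 : tsupport f ⊆ Ioi 0) (σ : ℝ)
    {ψ : (quasiSplit F E c N).Adelic → ℂ} {M : ℝ} (hψM : ∀ x, ‖ψ x‖ ≤ M) :
    ∃ C : ℝ, ∀ g : (quasiSplit F E c N).Adelic, ‖((borelHeight g : ℝ) : ℂ) ^ (-(σ : ℂ)) * f (borelHeight g : ℝ) * ψ g‖ ≤ C := by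
  obtain ⟨C, hC⟩ := exists_bound_radialCoeff (F := F) (E := E) (c := c) (N := N) hfc hfs hf0 σ
  have hC0 : 0 ≤ C := (norm_nonneg _).trans (hC 1)
  refine ⟨C * M, fun g => ?_⟩
  rw [norm_mul]
  exact mul_le_mul (hC g) (hψM g) (norm_nonneg _) hC0

/-- The twisted coefficient is left-`B(F)`-invariant (`borelU` spelling) when `ψ` is. [cite: Garrett2018, §2.2] -/
theorem twistedCoeff_borelU_mul (f : ℝ → ℂ) (σ : ℝ) {ψ : (quasiSplit F E c N).Adelic → ℂ}
    (hψB : ∀ b ∈ borelU (c : E →+* E) ((StdForm.antidiagonal N).over E), ∀ x : (quasiSplit F E c N).Adelic, ψ ((quasiSplit F E c N).toAdelic b * x) = ψ x) :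
    ∀ b ∈ borelU (c : E →+* E) ((StdForm.antidiagonal N).over E), ∀ x : (quasiSplit F E c N).Adelic,
      (fun g : (quasiSplit F E c N).Adelic => ((borelHeight g : ℝ) : ℂ) ^ (-(σ : ℂ)) * f (borelHeight g : ℝ) * ψ g) ((quasiSplit F E c N).toAdelic b * x) =
        (fun g : (quasiSplit F E c N).Adelic => ((borelHeight g : ℝ) : ℂ) ^ (-(σ : ℂ)) * f (borelHeight g : ℝ) * ψ g) x := by
  have hψB' := (forall_arithmeticBorel_iff (ψ := ψ)).2 hψB
  exact (forall_arithmeticBorel_iff (ψ := fun g : (quasiSplit F E c N).Adelic => ((borelHeight g : ℝ) : ℂ) ^ (-(σ : ℂ)) * f (borelHeight g : ℝ) * ψ g)).1 fun b hb x => by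
    simp only [K2E1TruncatedEisensteinExplicit.borelHeight_arithmeticBorel_mul hb, hψB' b hb x]

/-- `(f∘H)·ψ` is left-`B(F)`-invariant (arithmetic spelling) when `ψ` is (`borelU` spelling). [cite: Garrett2018, §2.2] -/
theorem comp_borelHeight_mul_arithmeticBorel_mul (f : ℝ → ℂ) {ψ : (quasiSplit F E c N).Adelic → ℂ}
    (hψB : ∀ b ∈ borelU (c : E →+* E) ((StdForm.antidiagonal N).over E), ∀ x : (quasiSplit F E c N).Adelic, ψ ((quasiSplit F E c N).toAdelic b * x) = ψ x) :
    ∀ b ∈ arithmeticBorel F E c N, ∀ x : (quasiSplit F E c N).Adelic,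
      (fun g : (quasiSplit F E c N).Adelic => f (borelHeight g : ℝ) * ψ g) ((b : (quasiSplit F E c N).Adelic) * x) = (fun g : (quasiSplit F E c N).Adelic => f (borelHeight g : ℝ) * ψ g) x := by
  have hψB' := (forall_arithmeticBorel_iff (ψ := ψ)).2 hψB
  intro b hb x
  simp only [K2E1TruncatedEisensteinExplicit.borelHeight_arithmeticBorel_mul hb, hψB' b hb x]

/-- `(f∘H)·ψ` is left-`B(F)`-invariant (`borelU` spelling) when `ψ` is. [cite: Garrett2018, §2.2] -/
theorem comp_borelHeight_mul_borelU_mul (f : ℝ → ℂ) {ψ : (quasiSplit F E c N).Adelic → ℂ}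
    (hψB : ∀ b ∈ borelU (c : E →+* E) ((StdForm.antidiagonal N).over E), ∀ x : (quasiSplit F E c N).Adelic, ψ ((quasiSplit F E c N).toAdelic b * x) = ψ x) :
    ∀ b ∈ borelU (c : E →+* E) ((StdForm.antidiagonal N).over E), ∀ x : (quasiSplit F E c N).Adelic,
      (fun g : (quasiSplit F E c N).Adelic => f (borelHeight g : ℝ) * ψ g) ((quasiSplit F E c N).toAdelic b * x) = (fun g : (quasiSplit F E c N).Adelic => f (borelHeight g : ℝ) * ψ g) x :=
  (forall_arithmeticBorel_iff (ψ := fun g : (quasiSplit F E c N).Adelic => f (borelHeight g : ℝ) * ψ g)).1 (comp_borelHeight_mul_arithmeticBorel_mul f hψB)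

/-- `(f∘H)·ψ` is left-`N(𝔸)`-invariant when `ψ` is (★ `borelHeight_unipotent_mul`). [cite: Garrett2018, §2.2] -/
theorem comp_borelHeight_mul_unipotent_mul (f : ℝ → ℂ) {ψ : (quasiSplit F E c N).Adelic → ℂ}
    (hψN : ∀ (u : ↥(adelicUnipotent F E c N)) (x : (quasiSplit F E c N).Adelic), ψ ((u : (quasiSplit F E c N).Adelic) * x) = ψ x) (u : ↥(adelicUnipotent F E c N)) (x : (quasiSplit F E c N).Adelic) :
    (fun g : (quasiSplit F E c N).Adelic => f (borelHeight g : ℝ) * ψ g) ((u : (quasiSplit F E c N).Adelic) * x) = (fun g : (quasiSplit F E c N).Adelic => f (borelHeight g : ℝ) * ψ g) x := by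
  simp only [borelHeight_unipotent_mul u.2, hψN u x]

/-- `θ_{f,ψ} = E((f∘H)·ψ)` is left-`G(F)`-invariant (any rank) when `ψ` is left-`B(F)`-invariant. [cite: MoeglinWaldspurger1995, II.1.5] -/
theorem eisensteinSeriesU_comp_borelHeight_mul_arithmeticSubgroup_mul (f : ℝ → ℂ) {ψ : (quasiSplit F E c N).Adelic → ℂ}
    (hψB : ∀ b ∈ borelU (c : E →+* E) ((StdForm.antidiagonal N).over E), ∀ x : (quasiSplit F E c N).Adelic, ψ ((quasiSplit F E c N).toAdelic b * x) = ψ x)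
    (γ : (quasiSplit F E c N).arithmeticSubgroup) (g : (quasiSplit F E c N).Adelic) :
    eisensteinSeriesU (fun x : (quasiSplit F E c N).Adelic => f (borelHeight x : ℝ) * ψ x) ((γ : (quasiSplit F E c N).Adelic) * g) =
      eisensteinSeriesU (fun x : (quasiSplit F E c N).Adelic => f (borelHeight x : ℝ) * ψ x) g := by
  rw [comp_borelHeight_mul_eq_flatSectionU f 2 ψ]
  exact eisensteinSeriesU_flatSectionU_arithmeticSubgroup_mul (φ := fun g : (quasiSplit F E c N).Adelic => ((borelHeight g : ℝ) : ℂ) ^ (-((2 : ℝ) : ℂ)) * f (borelHeight g : ℝ) * ψ g)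
    (twistedCoeff_borelU_mul f 2 hψB) _ γ g

/-- **CUSP VANISHING OF `θ_{f,ψ}` ON `U(J₂)`** (any quadratic `(F,E,c)`, any left-`B(F)`-invariant `ψ`): if `f = 0` off `(T⁻¹, T)` (`T ≥ 1`), then `θ_{f,ψ}(g) = 0` whenever `H(g) > T` — every
term dies through its `f`-factor exactly as in ★ D0 `eisensteinSeriesU_comp_borelHeight_eq_zero_of_lt` (Borel coset: `H(g) > T`; other cosets: `H(γg) ≤ H(g)⁻¹ < T⁻¹`, ★ big cell).
[cite: Garrett2018, §1.8 and §2.3] [cite: MoeglinWaldspurger1995, II.1.2] -/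
theorem eisensteinSeriesU_comp_borelHeight_mul_eq_zero_of_lt {f : ℝ → ℂ} {T : ℝ≥0} (hT : 1 ≤ T) (hhi : ∀ r : ℝ, (T : ℝ) < r → f r = 0) (hlo : ∀ r : ℝ, r < (T : ℝ)⁻¹ → f r = 0)
    {ψ : (quasiSplit F E c 2).Adelic → ℂ} (hψB : ∀ b ∈ borelU (c : E →+* E) ((StdForm.antidiagonal 2).over E), ∀ x : (quasiSplit F E c 2).Adelic, ψ ((quasiSplit F E c 2).toAdelic b * x) = ψ x)
    {g : (quasiSplit F E c 2).Adelic} (hg : T < borelHeight g) :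
    eisensteinSeriesU (fun x : (quasiSplit F E c 2).Adelic => f (borelHeight x : ℝ) * ψ x) g = 0 := by
  rw [eisensteinSeriesU_eq_tsum_arithmeticBorelQuot (comp_borelHeight_mul_arithmeticBorel_mul f hψB) g]
  have hT0 : (0 : ℝ≥0) < T := one_pos.trans_le hT
  have hg0 : (0 : ℝ≥0) < borelHeight g := hT0.trans hg
  have h0 : ∀ q : Quotient (QuotientGroup.rightRel (arithmeticBorel F E c 2)),
      f (borelHeight (((q.out : (quasiSplit F E c 2).arithmeticSubgroup) : (quasiSplit F E c 2).Adelic) * g) : ℝ) = 0 := by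
    intro q
    by_cases hq : q.out ∈ arithmeticBorel F E c 2
    · rw [K2E1TruncatedEisensteinExplicit.borelHeight_arithmeticBorel_mul hq]
      exact hhi _ (by exact_mod_cast hg)
    · refine hlo _ ?_
      have h1 := borelHeight_mul_borelHeight_le_one_of_not_mem_arithmeticBorel_two hq g
      have h2 : borelHeight (((q.out : (quasiSplit F E c 2).arithmeticSubgroup) : (quasiSplit F E c 2).Adelic) * g) ≤ (borelHeight g)⁻¹ :=
        (NNReal.le_inv_iff_mul_le hg0.ne').2 h1
      have h3 : ((borelHeight g)⁻¹ : ℝ≥0) < T⁻¹ := inv_strictAnti₀ hT0 hg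
      exact_mod_cast h2.trans_lt h3
  simp only [h0, zero_mul, tsum_zero]

end Generic

/-! ## §2 The CM pair `(L⁺, L, conj)`, `N = 2`: summability, continuity, boundedness, the constant term, the Mellin form of the intertwining integral -/

section CM

variable (L : Type) [Field L] [NumberField L] [IsCMField L]
variable [MeasurableSpace (quasiSplit (↥(maximalRealSubfield L)) L (IsCMField.complexConj L) 2).Adelic] [BorelSpace (quasiSplit (↥(maximalRealSubfield L)) L (IsCMField.complexConj L) 2).Adelic]

omit [MeasurableSpace (quasiSplit (↥(maximalRealSubfield L)) L (IsCMField.complexConj L) 2).Adelic] [BorelSpace (quasiSplit (↥(maximalRealSubfield L)) L (IsCMField.complexConj L) 2).Adelic] in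
/-- **`Σ_{γ ∈ B(F)∖G(F)} f(H(γg))·ψ(γg)` CONVERGES ABSOLUTELY** for `f ∈ C_c((0,∞))` and `ψ` bounded (★ `summable_flatSectionU_cm_two` at `z = 2`). [cite: MoeglinWaldspurger1995, II.1.2 and II.1.5] -/
theorem summable_comp_borelHeight_mul_cm_two {f : ℝ → ℂ} (hfc : Continuous f) (hfs : HasCompactSupport f) (hf0 : tsupport f ⊆ Ioi 0)
    {ψ : (quasiSplit (↥(maximalRealSubfield L)) L (IsCMField.complexConj L) 2).Adelic → ℂ} {M : ℝ} (hψM : ∀ x, ‖ψ x‖ ≤ M)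
    (g : (quasiSplit (↥(maximalRealSubfield L)) L (IsCMField.complexConj L) 2).Adelic) :
    Summable fun q : Quotient (orbitRel ↥(borelU ((IsCMField.complexConj L : L ≃ₐ[↥(maximalRealSubfield L)] L) : L →+* L) ((StdForm.antidiagonal 2).over L))
        ↥(unitaryGroupOfForm ((IsCMField.complexConj L : L ≃ₐ[↥(maximalRealSubfield L)] L) : L →+* L) ((StdForm.antidiagonal 2).over L))) =>
      f (borelHeight ((quasiSplit (↥(maximalRealSubfield L)) L (IsCMField.complexConj L) 2).toAdelic
          (Quotient.out q : ↥(unitaryGroupOfForm ((IsCMField.complexConj L : L ≃ₐ[↥(maximalRealSubfield L)] L) : L →+* L) ((StdForm.antidiagonal 2).over L))) * g) : ℝ) *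
        ψ ((quasiSplit (↥(maximalRealSubfield L)) L (IsCMField.complexConj L) 2).toAdelic
          (Quotient.out q : ↥(unitaryGroupOfForm ((IsCMField.complexConj L : L ≃ₐ[↥(maximalRealSubfield L)] L) : L →+* L) ((StdForm.antidiagonal 2).over L))) * g) := by
  set φ : (quasiSplit (↥(maximalRealSubfield L)) L (IsCMField.complexConj L) 2).Adelic → ℂ :=
    fun x => ((borelHeight x : ℝ) : ℂ) ^ (-((2 : ℝ) : ℂ)) * f (borelHeight x : ℝ) * ψ x with hφ
  obtain ⟨C, hC⟩ := exists_bound_twistedCoeff (F := ↥(maximalRealSubfield L)) (E := L) (c := IsCMField.complexConj L) (N := 2) hfc hfs hf0 2 hψM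
  have hE : ∀ x, f (borelHeight x : ℝ) * ψ x = flatSectionU φ ((2 : ℝ) : ℂ) x := fun x => congrFun (comp_borelHeight_mul_eq_flatSectionU f 2 ψ) x
  have h2 : 1 < (((2 : ℝ) : ℂ)).re := by rw [ofReal_re]; norm_num
  have h := summable_flatSectionU_cm_two L h2 (φ := φ) hC g
  simp only [← hE] at h
  exact h

omit [MeasurableSpace (quasiSplit (↥(maximalRealSubfield L)) L (IsCMField.complexConj L) 2).Adelic] [BorelSpace (quasiSplit (↥(maximalRealSubfield L)) L (IsCMField.complexConj L) 2).Adelic] in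
/-- **`θ_{f,ψ}` IS CONTINUOUS on `U(1,1)(𝔸_{L⁺})`** for `f ∈ C_c((0,∞))`, `ψ` continuous bounded (★ R4a at `z = 2`). [cite: MoeglinWaldspurger1995, II.1.5] [cite: Garrett2018, §2.8] -/
theorem continuous_eisensteinSeriesU_comp_borelHeight_mul_cm_two {f : ℝ → ℂ} (hfc : Continuous f) (hfs : HasCompactSupport f) (hf0 : tsupport f ⊆ Ioi 0)
    {ψ : (quasiSplit (↥(maximalRealSubfield L)) L (IsCMField.complexConj L) 2).Adelic → ℂ} (hψc : Continuous ψ) {M : ℝ} (hψM : ∀ x, ‖ψ x‖ ≤ M) :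
    Continuous (eisensteinSeriesU (fun x : (quasiSplit (↥(maximalRealSubfield L)) L (IsCMField.complexConj L) 2).Adelic => f (borelHeight x : ℝ) * ψ x)) := by
  obtain ⟨C, hC⟩ := exists_bound_twistedCoeff (F := ↥(maximalRealSubfield L)) (E := L) (c := IsCMField.complexConj L) (N := 2) hfc hfs hf0 2 hψM
  have h2 : 1 < (((2 : ℝ) : ℂ)).re := by rw [ofReal_re]; norm_num
  rw [comp_borelHeight_mul_eq_flatSectionU f 2 ψ]
  exact continuous_eisensteinSeriesU_flatSectionU_cm_two L h2 (continuous_twistedCoeff hfc hf0 2 hψc) hC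

/-- `θ_{f,ψ}` is Borel on `U(1,1)(𝔸_{L⁺})`. [cite: MoeglinWaldspurger1995, II.1.5] -/
theorem measurable_eisensteinSeriesU_comp_borelHeight_mul_cm_two {f : ℝ → ℂ} (hfc : Continuous f) (hfs : HasCompactSupport f) (hf0 : tsupport f ⊆ Ioi 0)
    {ψ : (quasiSplit (↥(maximalRealSubfield L)) L (IsCMField.complexConj L) 2).Adelic → ℂ} (hψc : Continuous ψ) {M : ℝ} (hψM : ∀ x, ‖ψ x‖ ≤ M) :
    Measurable (eisensteinSeriesU (fun x : (quasiSplit (↥(maximalRealSubfield L)) L (IsCMField.complexConj L) 2).Adelic => f (borelHeight x : ℝ) * ψ x)) :=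
  (continuous_eisensteinSeriesU_comp_borelHeight_mul_cm_two L hfc hfs hf0 hψc hψM).measurable

omit [MeasurableSpace (quasiSplit (↥(maximalRealSubfield L)) L (IsCMField.complexConj L) 2).Adelic] [BorelSpace (quasiSplit (↥(maximalRealSubfield L)) L (IsCMField.complexConj L) 2).Adelic] in
/-- **`θ_{f,ψ}` IS BOUNDED ON `U(1,1)(𝔸_{L⁺})`** for `f ∈ C_c((0,∞))`, `ψ` continuous bounded left-`B(L⁺)`-invariant: ★ reduction theory, the compact low part of the Siegel set + continuity below the
cut-off `T` of ★ `exists_one_le_forall_eq_zero`, cusp vanishing above it, `G(L⁺)`-invariance, ★ D0's case split. [cite: MoeglinWaldspurger1995, I.2.13 and II.1.2] [cite: Garrett2018, §1.8 and §2.10–§2.11] -/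
theorem exists_bound_eisensteinSeriesU_comp_borelHeight_mul_cm_two {f : ℝ → ℂ} (hfc : Continuous f) (hfs : HasCompactSupport f) (hf0 : tsupport f ⊆ Ioi 0)
    {ψ : (quasiSplit (↥(maximalRealSubfield L)) L (IsCMField.complexConj L) 2).Adelic → ℂ} (hψc : Continuous ψ) {M : ℝ} (hψM : ∀ x, ‖ψ x‖ ≤ M)
    (hψB : ∀ b ∈ borelU ((IsCMField.complexConj L : L ≃ₐ[↥(maximalRealSubfield L)] L) : L →+* L) ((StdForm.antidiagonal 2).over L), ∀ x : (quasiSplit (↥(maximalRealSubfield L)) L (IsCMField.complexConj L) 2).Adelic,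
      ψ ((quasiSplit (↥(maximalRealSubfield L)) L (IsCMField.complexConj L) 2).toAdelic b * x) = ψ x) :
    ∃ M₁ : ℝ, ∀ g : (quasiSplit (↥(maximalRealSubfield L)) L (IsCMField.complexConj L) 2).Adelic,
      ‖eisensteinSeriesU (fun x : (quasiSplit (↥(maximalRealSubfield L)) L (IsCMField.complexConj L) 2).Adelic => f (borelHeight x : ℝ) * ψ x) g‖ ≤ M₁ := by
  obtain ⟨T, hT, hhi, hlo⟩ := exists_one_le_forall_eq_zero hfs hf0
  obtain ⟨S, ⟨Ω, K, t, ht, hΩ, hΩc, hKc, rfl⟩, hcov⟩ := reductionTheoryU_two_antidiagonal L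
  obtain ⟨C, hC, hsub⟩ := exists_isCompact_siegel_low_two (exists_mem_borelAdelic_mul_mem_standardMaximalCompactGL_cm L) ht hΩ hΩc hKc T
  obtain ⟨M₀, hlow⟩ := exists_bound_low_of_isCompact hC hsub (continuous_eisensteinSeriesU_comp_borelHeight_mul_cm_two L hfc hfs hf0 hψc hψM).continuousOn
  exact ⟨max M₀ 0, norm_le_of_cover_of_eq_zero hcov (eisensteinSeriesU_comp_borelHeight_mul_arithmeticSubgroup_mul f hψB) hlow
    (fun g hg => eisensteinSeriesU_comp_borelHeight_mul_eq_zero_of_lt hT hhi hlo hψB hg)⟩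

/-- **THE CONSTANT TERM OF THE TWISTED RADIAL PSEUDO-EISENSTEIN SERIES**: for a Haar measure `ν` on `N(𝔸_{L⁺})`, a fundamental domain `𝓕` of `N(L⁺)` with compact closure, `f ∈ C_c((0,∞))`,
`ψ` continuous bounded left-`N(𝔸)`- and left-`B(L⁺)`-invariant, and every `g`:
**`θ_{f,ψ,B}(g) = f(Hg)·ψ(g) + (ν𝓕)⁻¹ • ∫_{N(𝔸)} f(H(w₀ v g))·ψ(w₀ v g) dν(v)`** — the SECTION-GENERIC ★ `borelConstantTerm_eisensteinSeriesU_flatSectionU_cm_two` at `z = 2` with coefficient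
`H^{−2}·(f∘H)·ψ`. [cite: MoeglinWaldspurger1995, II.1.7] [cite: Garrett2018, §2.8] -/
theorem borelConstantTerm_eisensteinSeriesU_comp_borelHeight_mul_cm_two (ν : Measure ↥(adelicUnipotent (↥(maximalRealSubfield L)) L (IsCMField.complexConj L) 2)) [ν.IsHaarMeasure]
    {𝓕 : Set ↥(adelicUnipotent (↥(maximalRealSubfield L)) L (IsCMField.complexConj L) 2)}
    (h𝓕N : IsFundamentalDomain ↥(rationalUnipotent (↥(maximalRealSubfield L)) L (IsCMField.complexConj L) 2) 𝓕 ν) (h𝓕c : IsCompact (closure 𝓕))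
    {f : ℝ → ℂ} (hfc : Continuous f) (hfs : HasCompactSupport f) (hf0 : tsupport f ⊆ Ioi 0)
    {ψ : (quasiSplit (↥(maximalRealSubfield L)) L (IsCMField.complexConj L) 2).Adelic → ℂ} (hψc : Continuous ψ) {M : ℝ} (hψM : ∀ x, ‖ψ x‖ ≤ M)
    (hψN : ∀ (u : ↥(adelicUnipotent (↥(maximalRealSubfield L)) L (IsCMField.complexConj L) 2)) (x : (quasiSplit (↥(maximalRealSubfield L)) L (IsCMField.complexConj L) 2).Adelic),
      ψ ((u : (quasiSplit (↥(maximalRealSubfield L)) L (IsCMField.complexConj L) 2).Adelic) * x) = ψ x)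
    (hψB : ∀ b ∈ borelU ((IsCMField.complexConj L : L ≃ₐ[↥(maximalRealSubfield L)] L) : L →+* L) ((StdForm.antidiagonal 2).over L), ∀ x : (quasiSplit (↥(maximalRealSubfield L)) L (IsCMField.complexConj L) 2).Adelic,
      ψ ((quasiSplit (↥(maximalRealSubfield L)) L (IsCMField.complexConj L) 2).toAdelic b * x) = ψ x)
    (g : (quasiSplit (↥(maximalRealSubfield L)) L (IsCMField.complexConj L) 2).Adelic) :
    borelConstantTerm ν 𝓕 (eisensteinSeriesU (fun x : (quasiSplit (↥(maximalRealSubfield L)) L (IsCMField.complexConj L) 2).Adelic => f (borelHeight x : ℝ) * ψ x)) g =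
      f (borelHeight g : ℝ) * ψ g + ((ν 𝓕).toReal⁻¹ : ℝ) • ∫ v : ↥(adelicUnipotent (↥(maximalRealSubfield L)) L (IsCMField.complexConj L) 2),
        f ((borelHeight ((quasiSplit (↥(maximalRealSubfield L)) L (IsCMField.complexConj L) 2).toAdelic (weylLongU ((IsCMField.complexConj L : L ≃ₐ[↥(maximalRealSubfield L)] L) : L →+* L) (rfl : (StdForm.antidiagonal 2).over L = (StdForm.antidiagonal 2).over L)) *
          (v : (quasiSplit (↥(maximalRealSubfield L)) L (IsCMField.complexConj L) 2).Adelic) * g)) : ℝ) *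
        ψ ((quasiSplit (↥(maximalRealSubfield L)) L (IsCMField.complexConj L) 2).toAdelic (weylLongU ((IsCMField.complexConj L : L ≃ₐ[↥(maximalRealSubfield L)] L) : L →+* L) (rfl : (StdForm.antidiagonal 2).over L = (StdForm.antidiagonal 2).over L)) *
          (v : (quasiSplit (↥(maximalRealSubfield L)) L (IsCMField.complexConj L) 2).Adelic) * g) ∂ν := by
  set φ : (quasiSplit (↥(maximalRealSubfield L)) L (IsCMField.complexConj L) 2).Adelic → ℂ :=
    fun x => ((borelHeight x : ℝ) : ℂ) ^ (-((2 : ℝ) : ℂ)) * f (borelHeight x : ℝ) * ψ x with hφ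
  obtain ⟨C, hC⟩ := exists_bound_twistedCoeff (F := ↥(maximalRealSubfield L)) (E := L) (c := IsCMField.complexConj L) (N := 2) hfc hfs hf0 2 hψM
  have hE : ∀ x, f (borelHeight x : ℝ) * ψ x = flatSectionU φ ((2 : ℝ) : ℂ) x := fun x => congrFun (comp_borelHeight_mul_eq_flatSectionU f 2 ψ) x
  have h2 : 1 < (((2 : ℝ) : ℂ)).re := by rw [ofReal_re]; norm_num
  have hφN : ∀ (u : ↥(adelicUnipotent (↥(maximalRealSubfield L)) L (IsCMField.complexConj L) 2)) (x : (quasiSplit (↥(maximalRealSubfield L)) L (IsCMField.complexConj L) 2).Adelic),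
      φ ((u : (quasiSplit (↥(maximalRealSubfield L)) L (IsCMField.complexConj L) 2).Adelic) * x) = φ x := fun u x => by
    simp only [hφ, borelHeight_unipotent_mul u.2, hψN u x]
  have h := borelConstantTerm_eisensteinSeriesU_flatSectionU_cm_two L ν h𝓕N h𝓕c (φ := φ) (continuous_twistedCoeff hfc hf0 2 hψc) hC hφN (twistedCoeff_borelU_mul f 2 hψB) h2 g
  rw [← comp_borelHeight_mul_eq_flatSectionU f 2 ψ] at h
  exact h

/-- **FUBINI INPUT FOR THE TWISTED MELLIN FORM**: for `σ₀ > 1`, `f ∈ C²_c((0,∞))`, `ψ` continuous bounded and every `g`, the double integrand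
`(v, y) ↦ (ψ·H^{σ₀+iy})(w₀vg)·f̃(σ₀+iy)` is integrable on `N(𝔸) × ℝ`: its norm is `≤ ‖ψ‖_∞·H(w₀vg)^{σ₀}·‖f̃(σ₀+iy)‖` (Godement ★ × vertically integrable ★ A).
[cite: MoeglinWaldspurger1995, II.1.4, II.1.6] -/
theorem integrable_flatSectionU_mul_mellin_prod_cm_two
    (ν : Measure ↥(adelicUnipotent (↥(maximalRealSubfield L)) L (IsCMField.complexConj L) 2)) [ν.IsHaarMeasure] {𝓕 : Set ↥(adelicUnipotent (↥(maximalRealSubfield L)) L (IsCMField.complexConj L) 2)}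
    (h𝓕N : IsFundamentalDomain ↥(rationalUnipotent (↥(maximalRealSubfield L)) L (IsCMField.complexConj L) 2) 𝓕 ν) (h𝓕c : IsCompact (closure 𝓕))
    {f : ℝ → ℂ} (hf : ContDiff ℝ 2 f) (hfs : HasCompactSupport f) (hf0 : tsupport f ⊆ Ioi 0)
    {ψ : (quasiSplit (↥(maximalRealSubfield L)) L (IsCMField.complexConj L) 2).Adelic → ℂ} (hψc : Continuous ψ) {M : ℝ} (hψM : ∀ x, ‖ψ x‖ ≤ M)
    {σ₀ : ℝ} (hσ₀ : 1 < σ₀) (g : (quasiSplit (↥(maximalRealSubfield L)) L (IsCMField.complexConj L) 2).Adelic) :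
    Integrable (Function.uncurry fun (v : ↥(adelicUnipotent (↥(maximalRealSubfield L)) L (IsCMField.complexConj L) 2)) (y : ℝ) =>
      flatSectionU ψ ((σ₀ : ℂ) + y * I) ((quasiSplit (↥(maximalRealSubfield L)) L (IsCMField.complexConj L) 2).toAdelic (weylLongU ((IsCMField.complexConj L : L ≃ₐ[↥(maximalRealSubfield L)] L) : L →+* L) (rfl : (StdForm.antidiagonal 2).over L = (StdForm.antidiagonal 2).over L)) * ((v : (quasiSplit (↥(maximalRealSubfield L)) L (IsCMField.complexConj L) 2).Adelic) * g)) *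
        mellin f (-((σ₀ : ℂ) + y * I))) (ν.prod volume) := by
  haveI := locallyCompactSpace_adeleRing' L
  haveI := sigmaFinite_haar_adelicUnipotent_cm_two L ν
  haveI : ν.IsInvInvariant := isInvInvariant_of_isHaarMeasure_two ν
  have hM0 : 0 ≤ M := (norm_nonneg _).trans (hψM 1)
  have hpos : ∀ v : ↥(adelicUnipotent (↥(maximalRealSubfield L)) L (IsCMField.complexConj L) 2), (0 : ℝ) < (borelHeight ((quasiSplit (↥(maximalRealSubfield L)) L (IsCMField.complexConj L) 2).toAdelic (weylLongU ((IsCMField.complexConj L : L ≃ₐ[↥(maximalRealSubfield L)] L) : L →+* L) (rfl : (StdForm.antidiagonal 2).over L = (StdForm.antidiagonal 2).over L)) * ((v : (quasiSplit (↥(maximalRealSubfield L)) L (IsCMField.complexConj L) 2).Adelic) * g)) : ℝ) := fun v => by exact_mod_cast borelHeight_pos _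
  have hGod := integrable_borelHeight_weylLongU_mul_rpow_cm_two L ν h𝓕N h𝓕c hσ₀ g
  have hFc : Continuous fun y : ℝ => mellin f (-((σ₀ : ℂ) + y * I)) := (differentiable_mellin hf.continuous hfs hf0).continuous.comp (by fun_prop)
  have hFi : Integrable fun y : ℝ => ‖mellin f (-((σ₀ : ℂ) + y * I))‖ := by
    have h := (verticalIntegrable_mellin hf hfs hf0 (-σ₀)).comp_neg
    refine (h.congr (Eventually.of_forall fun y => ?_)).norm
    show mellin f (((-σ₀ : ℝ) : ℂ) + ((-y : ℝ) : ℂ) * I) = mellin f (-((σ₀ : ℂ) + y * I))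
    congr 1; push_cast; ring
  have hprod : Integrable (fun p : ↥(adelicUnipotent (↥(maximalRealSubfield L)) L (IsCMField.complexConj L) 2) × ℝ =>
      (M * (borelHeight ((quasiSplit (↥(maximalRealSubfield L)) L (IsCMField.complexConj L) 2).toAdelic (weylLongU ((IsCMField.complexConj L : L ≃ₐ[↥(maximalRealSubfield L)] L) : L →+* L) (rfl : (StdForm.antidiagonal 2).over L = (StdForm.antidiagonal 2).over L)) * ((p.1 : (quasiSplit (↥(maximalRealSubfield L)) L (IsCMField.complexConj L) 2).Adelic) * g)) : ℝ) ^ σ₀) *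
        ‖mellin f (-((σ₀ : ℂ) + p.2 * I))‖) (ν.prod volume) :=
    (hGod.const_mul M).mul_prod hFi
  -- measurability of the complex integrand (continuity)
  have hwc : Continuous fun v : ↥(adelicUnipotent (↥(maximalRealSubfield L)) L (IsCMField.complexConj L) 2) =>
      (quasiSplit (↥(maximalRealSubfield L)) L (IsCMField.complexConj L) 2).toAdelic (weylLongU ((IsCMField.complexConj L : L ≃ₐ[↥(maximalRealSubfield L)] L) : L →+* L) (rfl : (StdForm.antidiagonal 2).over L = (StdForm.antidiagonal 2).over L)) * ((v : (quasiSplit (↥(maximalRealSubfield L)) L (IsCMField.complexConj L) 2).Adelic) * g) :=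
    continuous_const.mul (continuous_subtype_val.mul continuous_const)
  have hHc : Continuous fun v : ↥(adelicUnipotent (↥(maximalRealSubfield L)) L (IsCMField.complexConj L) 2) => (((borelHeight ((quasiSplit (↥(maximalRealSubfield L)) L (IsCMField.complexConj L) 2).toAdelic (weylLongU ((IsCMField.complexConj L : L ≃ₐ[↥(maximalRealSubfield L)] L) : L →+* L) (rfl : (StdForm.antidiagonal 2).over L = (StdForm.antidiagonal 2).over L)) * ((v : (quasiSplit (↥(maximalRealSubfield L)) L (IsCMField.complexConj L) 2).Adelic) * g))) : ℝ) : ℂ) :=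
    continuous_ofReal.comp (NNReal.continuous_coe.comp (continuous_borelHeight.comp hwc))
  have hΦc : Continuous (Function.uncurry fun (v : ↥(adelicUnipotent (↥(maximalRealSubfield L)) L (IsCMField.complexConj L) 2)) (y : ℝ) =>
      flatSectionU ψ ((σ₀ : ℂ) + y * I) ((quasiSplit (↥(maximalRealSubfield L)) L (IsCMField.complexConj L) 2).toAdelic (weylLongU ((IsCMField.complexConj L : L ≃ₐ[↥(maximalRealSubfield L)] L) : L →+* L) (rfl : (StdForm.antidiagonal 2).over L = (StdForm.antidiagonal 2).over L)) * ((v : (quasiSplit (↥(maximalRealSubfield L)) L (IsCMField.complexConj L) 2).Adelic) * g)) *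
        mellin f (-((σ₀ : ℂ) + y * I))) := by
    simp only [Function.uncurry_def, flatSectionU_apply]
    refine (((hψc.comp hwc).comp continuous_fst).mul ((hHc.comp continuous_fst).cpow (by fun_prop) fun p => ?_)).mul (hFc.comp continuous_snd)
    exact ofReal_mem_slitPlane.2 (hpos p.1)
  refine hprod.mono' hΦc.aestronglyMeasurable (Eventually.of_forall fun p => ?_)
  show ‖flatSectionU ψ ((σ₀ : ℂ) + p.2 * I) ((quasiSplit (↥(maximalRealSubfield L)) L (IsCMField.complexConj L) 2).toAdelic (weylLongU ((IsCMField.complexConj L : L ≃ₐ[↥(maximalRealSubfield L)] L) : L →+* L) (rfl : (StdForm.antidiagonal 2).over L = (StdForm.antidiagonal 2).over L)) * ((p.1 : (quasiSplit (↥(maximalRealSubfield L)) L (IsCMField.complexConj L) 2).Adelic) * g)) *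
      mellin f (-((σ₀ : ℂ) + p.2 * I))‖ ≤ _
  rw [flatSectionU_apply, norm_mul, norm_mul, norm_cpow_eq_rpow_re_of_pos (hpos p.1)]
  have hre : ((σ₀ : ℂ) + p.2 * I).re = σ₀ := by simp
  rw [hre]
  exact mul_le_mul_of_nonneg_right (mul_le_mul_of_nonneg_right (hψM _) (Real.rpow_nonneg (hpos p.1).le _)) (norm_nonneg _)

/-- **THE MELLIN FORM OF THE TWISTED INTERTWINING INTEGRAL**: for a Haar measure `ν` on `N(𝔸_{L⁺})` (fundamental domain `𝓕` of `N(L⁺)` of compact closure — Godement's input), `f ∈ C²_c((0,∞))`,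
`ψ` continuous bounded, `σ₀ > 1` and every `g`:
**`∫_{N(𝔸)} f(H(w₀vg))·ψ(w₀vg) dν(v) = (2π)⁻¹ ∫_ℝ f̃(σ₀+iy)·(∫_{N(𝔸)} (ψ·H^{σ₀+iy})(w₀vg) dν(v)) dy`**, `f̃(z) = mellin f (−z)` — Mellin inversion ★ A under the `ν`-integral, Fubini
(`integrable_flatSectionU_mul_mellin_prod_cm_two`); the inner integral is `(M(z)ψ)(g)·H(g)^{1−z}` with the intertwined coefficient `M(z)ψ` of ★ row 3 (`K2E1ChiIntertwinedSectionU2`), the `ψ`-twin of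
★ B's `c(z)·H(g)^{1−z}`. [cite: MoeglinWaldspurger1995, II.1.4, II.1.6, II.2.1] [cite: GelbartRogawski1991, §3.1] [cite: Titchmarsh1948, Thm 71–72] -/
theorem integral_comp_borelHeight_mul_weylLongU_eq_mellin_cm_two
    (ν : Measure ↥(adelicUnipotent (↥(maximalRealSubfield L)) L (IsCMField.complexConj L) 2)) [ν.IsHaarMeasure] {𝓕 : Set ↥(adelicUnipotent (↥(maximalRealSubfield L)) L (IsCMField.complexConj L) 2)}
    (h𝓕N : IsFundamentalDomain ↥(rationalUnipotent (↥(maximalRealSubfield L)) L (IsCMField.complexConj L) 2) 𝓕 ν) (h𝓕c : IsCompact (closure 𝓕))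
    {f : ℝ → ℂ} (hf : ContDiff ℝ 2 f) (hfs : HasCompactSupport f) (hf0 : tsupport f ⊆ Ioi 0)
    {ψ : (quasiSplit (↥(maximalRealSubfield L)) L (IsCMField.complexConj L) 2).Adelic → ℂ} (hψc : Continuous ψ) {M : ℝ} (hψM : ∀ x, ‖ψ x‖ ≤ M)
    {σ₀ : ℝ} (hσ₀ : 1 < σ₀) (g : (quasiSplit (↥(maximalRealSubfield L)) L (IsCMField.complexConj L) 2).Adelic) :
    ∫ v : ↥(adelicUnipotent (↥(maximalRealSubfield L)) L (IsCMField.complexConj L) 2),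
        f ((borelHeight ((quasiSplit (↥(maximalRealSubfield L)) L (IsCMField.complexConj L) 2).toAdelic (weylLongU ((IsCMField.complexConj L : L ≃ₐ[↥(maximalRealSubfield L)] L) : L →+* L) (rfl : (StdForm.antidiagonal 2).over L = (StdForm.antidiagonal 2).over L)) * ((v : (quasiSplit (↥(maximalRealSubfield L)) L (IsCMField.complexConj L) 2).Adelic) * g))) : ℝ) *
          ψ ((quasiSplit (↥(maximalRealSubfield L)) L (IsCMField.complexConj L) 2).toAdelic (weylLongU ((IsCMField.complexConj L : L ≃ₐ[↥(maximalRealSubfield L)] L) : L →+* L) (rfl : (StdForm.antidiagonal 2).over L = (StdForm.antidiagonal 2).over L)) * ((v : (quasiSplit (↥(maximalRealSubfield L)) L (IsCMField.complexConj L) 2).Adelic) * g)) ∂ν =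
      (((2 * π)⁻¹ : ℝ) : ℂ) * ∫ y : ℝ, mellin f (-((σ₀ : ℂ) + y * I)) *
        ∫ v : ↥(adelicUnipotent (↥(maximalRealSubfield L)) L (IsCMField.complexConj L) 2),
          flatSectionU ψ ((σ₀ : ℂ) + y * I) ((quasiSplit (↥(maximalRealSubfield L)) L (IsCMField.complexConj L) 2).toAdelic (weylLongU ((IsCMField.complexConj L : L ≃ₐ[↥(maximalRealSubfield L)] L) : L →+* L) (rfl : (StdForm.antidiagonal 2).over L = (StdForm.antidiagonal 2).over L)) * ((v : (quasiSplit (↥(maximalRealSubfield L)) L (IsCMField.complexConj L) 2).Adelic) * g)) ∂ν := by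
  haveI := sigmaFinite_haar_adelicUnipotent_cm_two L ν
  have hpos : ∀ v : ↥(adelicUnipotent (↥(maximalRealSubfield L)) L (IsCMField.complexConj L) 2), (0 : ℝ) < (borelHeight ((quasiSplit (↥(maximalRealSubfield L)) L (IsCMField.complexConj L) 2).toAdelic (weylLongU ((IsCMField.complexConj L : L ≃ₐ[↥(maximalRealSubfield L)] L) : L →+* L) (rfl : (StdForm.antidiagonal 2).over L = (StdForm.antidiagonal 2).over L)) * ((v : (quasiSplit (↥(maximalRealSubfield L)) L (IsCMField.complexConj L) 2).Adelic) * g)) : ℝ) := fun v => by exact_mod_cast borelHeight_pos _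
  have hΦi := integrable_flatSectionU_mul_mellin_prod_cm_two L ν h𝓕N h𝓕c hf hfs hf0 hψc hψM hσ₀ g
  -- (1) Mellin inversion under the `ν`-integral: `f(H)·ψ = (2π)⁻¹ ∫ (ψ·H^z)·f̃(z) dy`
  have hinv : (fun v : ↥(adelicUnipotent (↥(maximalRealSubfield L)) L (IsCMField.complexConj L) 2) =>
      f ((borelHeight ((quasiSplit (↥(maximalRealSubfield L)) L (IsCMField.complexConj L) 2).toAdelic (weylLongU ((IsCMField.complexConj L : L ≃ₐ[↥(maximalRealSubfield L)] L) : L →+* L) (rfl : (StdForm.antidiagonal 2).over L = (StdForm.antidiagonal 2).over L)) * ((v : (quasiSplit (↥(maximalRealSubfield L)) L (IsCMField.complexConj L) 2).Adelic) * g))) : ℝ) *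
        ψ ((quasiSplit (↥(maximalRealSubfield L)) L (IsCMField.complexConj L) 2).toAdelic (weylLongU ((IsCMField.complexConj L : L ≃ₐ[↥(maximalRealSubfield L)] L) : L →+* L) (rfl : (StdForm.antidiagonal 2).over L = (StdForm.antidiagonal 2).over L)) * ((v : (quasiSplit (↥(maximalRealSubfield L)) L (IsCMField.complexConj L) 2).Adelic) * g))) =
      fun v : ↥(adelicUnipotent (↥(maximalRealSubfield L)) L (IsCMField.complexConj L) 2) => (((2 * π)⁻¹ : ℝ) : ℂ) * ∫ y : ℝ, flatSectionU ψ ((σ₀ : ℂ) + y * I) ((quasiSplit (↥(maximalRealSubfield L)) L (IsCMField.complexConj L) 2).toAdelic (weylLongU ((IsCMField.complexConj L : L ≃ₐ[↥(maximalRealSubfield L)] L) : L →+* L) (rfl : (StdForm.antidiagonal 2).over L = (StdForm.antidiagonal 2).over L)) * ((v : (quasiSplit (↥(maximalRealSubfield L)) L (IsCMField.complexConj L) 2).Adelic) * g)) *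
        mellin f (-((σ₀ : ℂ) + y * I)) := by
    funext v
    rw [eq_integral_cpow_mul_mellin_neg hf hfs hf0 σ₀ (hpos v), mul_comm, ← mul_assoc, mul_comm (ψ _), mul_assoc, ← integral_const_mul]
    congr 1
    exact integral_congr_ae (Eventually.of_forall fun y => by simp only [flatSectionU_apply]; ring)
  rw [hinv, integral_const_mul]
  congr 1
  -- (2) Fubini over `N(𝔸) × ℝ`, then pull `f̃(z)` out of the inner integral
  rw [integral_integral_swap hΦi]
  refine integral_congr_ae (Eventually.of_forall fun y => ?_)
  dsimp only
  rw [integral_mul_const, mul_comm]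

end CM

end Summit.HodgeConjecture.HodgeConjecture.Cruxes.H413.K2E1ChiPseudoEisensteinRadialCMTwo

end
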